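import Summits.AnomalousDissipation.AnomalousDissipation.Theses.TwoAndHalfD
import Summits.AnomalousDissipation.AnomalousDissipation.Theorems.TwoAndHalfDTwohalfdThesisClassicalTransfer
import Literature.Analysis.FluidPDE.TwoHalfNavierStokes
import Literature.Analysis.FluidPDE.PassiveScalar

/-!
# Strategist census, seat s2 — crux `TwoAndHalfD.TwohalfdThesis` (stmt-AnomalousDissipation-0206)

Typed companions of `STRATEGY-CENSUS.md` (v2, crux-strategist seat `cstrat-stmt-AnomalousDissipation-0206-s2`,
2026-08-17).  Nothing here is a line or a registered stub and nothing touches the lead's skeleton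
`Cruxes/TwohalfdThesis/Lines/Sketch.lean`; these are the SIGNATURES the census refers to, checked to elaborate
against the current tree, plus two kernel-checked implications.

* `TravellingWaveTwohalfdWitness`, `travellingWaveTwohalfdWitness_imp` — the STRENGTHEN candidate `S⁺_tw`
  (relative-equilibrium / travelling-wave witnesses: the only time dependence a steady force hands out for free,
  through the translation group of `T²`) and `S⁺_tw → TwohalfdThesis` over the landed classical junction
  `Theorems.TwohalfdThesis.twohalfdThesis_of_classicalScalarAnomaly` (p90898).  The census explains why `S⁺_tw` is
  dead (comoving frame: steady drift, Doppler-detuned source; streamline solvability for the resonant part).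
* `IsOddSectorInviscidMixer` / `OddSectorInviscidMixer` (`Sub₁`, `∃`), `SectorMixingGivesHalfLife` (`Sub₂`, `∀`),
  `OddSectorHalfLifeFamily` and `oddSectorHalfLifeFamily_of_split` — the best typed DECOMPOSITION this seat could
  produce that survives the landed selectivity no-go (`stub_nonselectiveNoGo`, p146373): the mixing hypothesis is an
  OPERATOR-norm inviscid (`κ = 0`) exponential mixing estimate on the ODD sector of the point reflection
  `P x = -x` only (the sector that does not contain the torque pattern `curl g`), at a rate `γ_j` whose
  Coti Zelati–Delgadino–Elgindi time `(1 + log²(γ_j/ν_j))/γ_j` stays bounded, and the bridge `Sub₂` is the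
  sector-restricted, rescaled form of CZDE 2020 Thm "Exponential mixing" (arXiv:1806.03258 §1.4, time-scale
  `O(|ln ν|²)`).  The composition lands on clause (c) of crux #2's registered stub `stub_oddSectorMixingFamily`
  (line `isotypic-source-selection`, stmt-0448) — i.e. on the sibling's kernel, not beside it; the census records
  why `Sub₁` is the whole crux in a harder currency.
-/

noncomputable section

set_option linter.dupNamespace false

namespace Summit.AnomalousDissipation.AnomalousDissipation.Cruxes.TwohalfdThesis.StrategistCensusS2

open MeasureTheory Set Filter Topology
open scoped ENNReal NNReal InnerProductSpace
open Literature.Analysis.FunctionSpaces Literature.Analysis.FluidPDE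
open Summit.AnomalousDissipation.AnomalousDissipation.Theses.TwoAndHalfD

/-- Local notation: the flat unit two-torus. -/
local notation "𝕋²" => UnitAddTorus (Fin 2)
/-- Local notation: planar velocity values. -/
local notation "E²" => EuclideanSpace ℝ (Fin 2)

/-! ## Strengthen: `S⁺_tw` — travelling-wave (relative-equilibrium) witnesses -/

/-- The point of `T²` reached from the origin after time `t` at constant velocity `c : Fin 2 → ℝ`
(componentwise `t·cᵢ mod 1`). -/
def twShift (c : Fin 2 → ℝ) (t : ℝ) : 𝕋² := fun i => ((t * c i : ℝ) : UnitAddCircle)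

/-- **`S⁺_tw` (STRENGTHEN candidate).**  One smooth solenoidal mean-zero steady planar force `g`, one smooth
mean-zero steady source `h`, `ν_j → 0`, and for every `j` PROFILES `V_j` (velocity), `P_j` (pressure), `W_j`
(scalar) and a wave velocity `c_j : Fin 2 → ℝ` such that the TRAVELLING WAVES
`v_j(t,x) = V_j(x − t c_j)`, `p_j(t,x) = P_j(x − t c_j)`, `θ_j(t,x) = W_j(x − t c_j)` are a classical planar
Navier–Stokes solution forced by `g` and a classical sourced scalar (source `h`, diffusivity `ν_j`) on `[0,∞)`,
with pointwise budgets `∫‖v_j(t)‖² ≤ E`, `‖θ_j(t)‖² ≤ B` and the crux's own `limsup`-mean dissipation floor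
`⟨ν_j‖∇θ_j‖²⟩ ≥ ε > 0`.  (For `c_j ∉` the stabiliser of `g` the NS clause itself forces `g` to be invariant
along `c_j`; the definition does not pre-judge this — it is part of what a witness would have to arrange.)
Relative equilibria are the only time-dependent states a steady force produces by symmetry alone; the census
(§ Strengthen, S-1) records why none is a witness: in the comoving frame the drift `V_j − c_j` is STEADY and the
source `h(· + t c_j)` is Doppler-detuned — the resonant (`c_j`-invariant) part of `h` meets streamline
solvability (`ν‖∇W‖² = ⟨h, W⟩ → 0` along bounded-variance branches), the detuned part has `O(1)` variance but
`O(ν_j^{1/3})`…`O(ν_j)` dissipation (autonomous relaxation rates, arXiv:2211.14057 Thm 1; swept laminar states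
`Literature.Barriers.AnomalousDissipation.exists_firstMode_boundedMeanEnergy_family`). -/
def TravellingWaveTwohalfdWitness : Prop :=
  ∃ (g : 𝕋² → E²) (h : 𝕋² → ℝ),
    Torus.IsSmooth g ∧ Torus.IsDivFree g ∧ Torus.HasZeroMean g ∧ Torus.IsSmooth h ∧ Torus.HasZeroMean h ∧
    ∃ (ν : ℕ → ℝ) (V : ℕ → 𝕋² → E²) (P : ℕ → 𝕋² → ℝ) (W : ℕ → 𝕋² → ℝ) (c : ℕ → Fin 2 → ℝ) (E B ε : ℝ),
      (∀ j, 0 < ν j) ∧ Tendsto ν atTop (𝓝 0) ∧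
      (∀ j, Torus.IsClassicalNSSolutionOn (Ici 0) (ν j) (fun _ => g)
        (fun t x => V j (x - twShift (c j) t)) (fun t x => P j (x - twShift (c j) t))) ∧
      (∀ j, Torus.IsClassicalScalarTransportForcedOn (Ici 0) (ν j) (fun t x => V j (x - twShift (c j) t))
        (fun _ => h) (fun t x => W j (x - twShift (c j) t))) ∧
      (∀ j t, 0 ≤ t → ∫ x, ‖V j (x - twShift (c j) t)‖ ^ 2 ≤ E) ∧
      (∀ j t, 0 ≤ t → Torus.scalarL2Sq (fun x => W j (x - twShift (c j) t)) ≤ B) ∧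
      0 < ε ∧ ∀ j, ε ≤ longTimeAvgSup
        (fun t => ν j * (Torus.eScalarGradNormSq (fun x => W j (x - twShift (c j) t))).toReal)

/-- **`S⁺_tw → X`** (bookkeeping over the landed classical junction p90898: a travelling-wave classical pair is a
classical pair on `[0, ∞)` with pointwise budgets). [folklore] -/
theorem travellingWaveTwohalfdWitness_imp : TravellingWaveTwohalfdWitness → TwohalfdThesis := by
  rintro ⟨g, h, hgs, hgd, hgm, hhs, hhm, ν, V, P, W, c, E, B, ε, hν, hν0, hNS, hSc, hE, hB, hε, hfl⟩
  exact Summit.AnomalousDissipation.AnomalousDissipation.Theorems.TwohalfdThesis.twohalfdThesis_of_classicalScalarAnomaly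
    ⟨g, h, hgs, hgd, hgm, hhs, hhm, ν, fun j t x => V j (x - twShift (c j) t),
      fun j t x => P j (x - twShift (c j) t), fun j t x => W j (x - twShift (c j) t), E, B, ε, hν, hν0,
      hNS, hSc, hE, hB, hε, hfl⟩

/-! ## Decomposition: the sector-inviscid split `X ⇐ … ⇐ Sub₁ ∧ Sub₂` (and why `Sub₁` is the whole crux) -/

/-- Shared body of the `∃`-piece `Sub₁`: a steadily forced, pointwise-bounded-energy CLASSICAL planar
Navier–Stokes family `(v_j, p_j)` under a `P`-equivariant force (`g(−x) = −g(x)`), itself `P`-equivariant for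
`t ≥ 0` (so the four half-lattice points are pinned stagnation points and the odd/even sectors of
`L²(T²)` are invariant under transport AND diffusion), with Lipschitz slices (constant `K_j`), whose INVISCID
(`κ = 0`) transport mixes the ODD sector `Ḣ¹ → Ḣ⁻¹` at an exponential OPERATOR rate: every classical solution
`ρ` of `∂ₜρ + v_j·∇ρ = 0` on `[s, ∞)`, `s ≥ s₀`, released from a smooth ODD datum `ρ₀` satisfies
`|∫ ρ(t) χ| ≤ C e^{−γ_j (t−s)} ‖∇ρ₀‖ ‖∇χ‖` against every smooth observable `χ`.  Nothing is asked of even data —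
in particular nothing of the torque pattern `curl g` (even), which is how the split survives
`stub_nonselectiveNoGo` (p146373). -/
def IsOddSectorInviscidMixer (g : 𝕋² → E²) (ν : ℕ → ℝ) (v : ℕ → ℝ → 𝕋² → E²) (p : ℕ → ℝ → 𝕋² → ℝ)
    (γ : ℕ → ℝ) (K : ℕ → ℝ≥0) (C E s₀ : ℝ) : Prop :=
  Torus.IsSmooth g ∧ Torus.IsDivFree g ∧ Torus.HasZeroMean g ∧ (∀ x, g (-x) = -g x) ∧
  (∀ j, 0 < ν j) ∧ Tendsto ν atTop (𝓝 0) ∧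
  (∀ j, Torus.IsClassicalNSSolutionOn (Ici 0) (ν j) (fun _ => g) (v j) (p j)) ∧
  (∀ j t, 0 ≤ t → ∀ x, v j t (-x) = -v j t x) ∧
  (∀ j t, 0 ≤ t → ∫ x, ‖v j t x‖ ^ 2 ≤ E) ∧
  (∀ j t, 0 ≤ t → LipschitzWith (K j) (v j t)) ∧
  0 ≤ s₀ ∧ 0 < C ∧ (∀ j, 0 < γ j) ∧
  ∀ (j : ℕ) (s : ℝ) (ρ₀ : 𝕋² → ℝ) (ρ : ℝ → 𝕋² → ℝ), s₀ ≤ s → Torus.IsSmooth ρ₀ → (∀ x, ρ₀ (-x) = -ρ₀ x) →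
    Torus.IsClassicalScalarTransportOn (Ici s) 0 (v j) ρ → ρ s = ρ₀ →
    ∀ (χ : 𝕋² → ℝ) (t : ℝ), Torus.IsSmooth χ → s ≤ t →
      |∫ x, ρ t x * χ x| ≤
        C * Real.exp (-(γ j * (t - s))) * Real.sqrt (Torus.scalarGradNormSq ρ₀) *
          Real.sqrt (Torus.scalarGradNormSq χ)

/-- **`Sub₁` (`∃`-piece): an odd-sector inviscid exponential mixer realised by steadily forced, bounded-energy,
`P`-equivariant planar NS, FAST ENOUGH FOR PRANDTL ONE** — the slice Lipschitz constants are comparable to the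
mixing rate (`K_j ≤ K₀ γ_j`, the "clean mixer" regime in which the CZDE constant is scale-free) and the
Coti Zelati–Delgadino–Elgindi time at diffusivity `ν_j`, `(1 + log²(γ_j/ν_j))/γ_j`, stays below one `T₀`
(equivalently `γ_j ≳ log²(1/ν_j)`: one logarithm ABOVE the certified necessary strain floor `c·log(1/ν_j)` of
`stub_witnessWindow` p141528, and far inside the enstrophy cap `C ν_j^{-1/2}` of `stub_planarEnstrophyCeiling`
p140763). -/
def OddSectorInviscidMixer : Prop :=
  ∃ (g : 𝕋² → E²) (ν : ℕ → ℝ) (v : ℕ → ℝ → 𝕋² → E²) (p : ℕ → ℝ → 𝕋² → ℝ) (γ : ℕ → ℝ) (K : ℕ → ℝ≥0)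
    (C E s₀ K₀ T₀ : ℝ),
    IsOddSectorInviscidMixer g ν v p γ K C E s₀ ∧ 0 < K₀ ∧
    (∀ j, ((K j : ℝ≥0) : ℝ) ≤ K₀ * γ j) ∧ (∀ j, ν j < γ j) ∧
    (∀ j, (1 + Real.log (γ j / ν j) ^ 2) / γ j ≤ T₀)

/-- **`Sub₂` (`∀`-piece): the SECTOR FENG–IYER / CZDE BRIDGE.**  For every `C, K₀ > 0` there is `A > 0` such
that: whenever a `P`-equivariant classical drift family as above mixes the odd sector inviscidly at operator rate
`γ_j` with constant `C` and slice Lipschitz constants `≤ K₀ γ_j`, then at ANY diffusivity `κ ∈ (0, γ_j)` every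
classical solution `φ` of `∂ₜφ + v_j·∇φ = κΔφ` on a window `[s, s + τ']`, `s ≥ s₀`, with ODD datum `φ(s)` is
QUARTERED, `‖φ(s+τ')‖² ≤ ¼‖φ(s)‖²`, as soon as `τ' ≥ A (1 + log²(γ_j/κ))/γ_j`.  This is Coti Zelati–Delgadino–
Elgindi, CPAM 2020 (arXiv:1806.03258 §1.4 "Exponential mixing", time-scale `O(|ln ν|²)`; discrete-time twin
Feng–Iyer, Nonlinearity 2019, arXiv:1806.03699 Thm 1: `τ_d ≤ C|ln ν|²`) after the time rescaling `t ↦ γ_j t`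
(mixing rate `1`, Lipschitz `≤ K₀`, diffusivity `κ/γ_j`), RESTRICTED TO THE ODD SECTOR — legitimate because their
argument only ever evolves the datum's own sector (odd data stay odd under transport by an odd drift and under
`Δ`) — and stated for all longer windows by `L²`-contractivity.  In print up to this bookkeeping; size L–XL to
formalise; referee-grade and bankable whatever happens to the crux.  [cite: arXiv:1806.03258, §1.4]
[cite: arXiv:1806.03699, Thm 1] -/
def SectorMixingGivesHalfLife : Prop :=
  ∀ (C K₀ : ℝ), 0 < C → 0 < K₀ → ∃ A : ℝ, 0 < A ∧
    ∀ (g : 𝕋² → E²) (ν : ℕ → ℝ) (v : ℕ → ℝ → 𝕋² → E²) (p : ℕ → ℝ → 𝕋² → ℝ) (γ : ℕ → ℝ) (K : ℕ → ℝ≥0)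
      (E s₀ : ℝ),
      IsOddSectorInviscidMixer g ν v p γ K C E s₀ → (∀ j, ((K j : ℝ≥0) : ℝ) ≤ K₀ * γ j) →
      ∀ (j : ℕ) (κ : ℝ), 0 < κ → κ < γ j →
        ∀ (τ' : ℝ), A * ((1 + Real.log (γ j / κ) ^ 2) / γ j) ≤ τ' →
          ∀ (s : ℝ) (φ : ℝ → 𝕋² → ℝ), s₀ ≤ s →
            Torus.IsClassicalScalarTransportOn (Icc s (s + τ')) κ (v j) φ → (∀ x, φ s (-x) = -φ s x) →
            Torus.scalarL2Sq (φ (s + τ')) ≤ 4⁻¹ * Torus.scalarL2Sq (φ s)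

/-- **What the split delivers: clause (c) of crux #2's registered kernel** (`stub_oddSectorMixingFamily` of the
line `isotypic-source-selection` on stmt-AnomalousDissipation-0448, minus its input-floor clause (d), at the
classical level and at PRANDTL ONE, `κ = ν_j`): a steadily forced bounded-energy `P`-equivariant classical
planar NS family whose odd sector has ONE half-life `τ` uniformly in `j` and in the release time `s ≥ s₀`. -/
def OddSectorHalfLifeFamily : Prop :=
  ∃ (g : 𝕋² → E²) (ν : ℕ → ℝ) (v : ℕ → ℝ → 𝕋² → E²) (p : ℕ → ℝ → 𝕋² → ℝ) (E s₀ τ : ℝ),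
    Torus.IsSmooth g ∧ Torus.IsDivFree g ∧ Torus.HasZeroMean g ∧ (∀ x, g (-x) = -g x) ∧
    (∀ j, 0 < ν j) ∧ Tendsto ν atTop (𝓝 0) ∧
    (∀ j, Torus.IsClassicalNSSolutionOn (Ici 0) (ν j) (fun _ => g) (v j) (p j)) ∧
    (∀ j t, 0 ≤ t → ∀ x, v j t (-x) = -v j t x) ∧
    (∀ j t, 0 ≤ t → ∫ x, ‖v j t x‖ ^ 2 ≤ E) ∧
    0 ≤ s₀ ∧ 0 < τ ∧
    ∀ (j : ℕ) (s : ℝ) (φ : ℝ → 𝕋² → ℝ), s₀ ≤ s →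
      Torus.IsClassicalScalarTransportOn (Icc s (s + τ)) (ν j) (v j) φ → (∀ x, φ s (-x) = -φ s x) →
      Torus.scalarL2Sq (φ (s + τ)) ≤ 4⁻¹ * Torus.scalarL2Sq (φ s)

/-- **Glue of the split (logic only, which is the point):** `Sub₁ → Sub₂ → OddSectorHalfLifeFamily` with the
uniform half-life `τ := A·T₀`.  All open DYNAMICS sits in `Sub₁` (inviscid operator mixing of the odd sector at
rate `≳ log²(1/ν_j)` by DETERMINISTIC steadily forced bounded-energy NS — no tool: every exponential-mixing theorem
for Navier–Stokes velocities needs noise, arXiv:1911.11014, and every deterministic fast mixer in print is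
PRESCRIBED, arXiv:2304.05374 / Yao–Zlatoš / Alberti–Crippa–Mazzucato); `Sub₂` is the in-print bridge. [folklore] -/
theorem oddSectorHalfLifeFamily_of_split (h1 : OddSectorInviscidMixer) (h2 : SectorMixingGivesHalfLife) :
    OddSectorHalfLifeFamily := by
  obtain ⟨g, ν, v, p, γ, K, C, E, s₀, K₀, T₀, hmix, hK₀, hK, hνγ, hT₀⟩ := h1
  have hC : 0 < C := hmix.2.2.2.2.2.2.2.2.2.2.2.1
  obtain ⟨A, hA, hbridge⟩ := h2 C K₀ hC hK₀
  have hb := hbridge g ν v p γ K E s₀ hmix hK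
  obtain ⟨hgs, hgd, hgm, hgodd, hν, hν0, hNS, hvodd, hE, -, hs₀, -, hγ, -⟩ := hmix
  refine ⟨g, ν, v, p, E, s₀, A * T₀, hgs, hgd, hgm, hgodd, hν, hν0, hNS, hvodd, hE, hs₀, ?_, ?_⟩
  · -- `T₀ > 0`: it dominates `(1 + log²)/γ₀ > 0`
    have h0 : 0 < (1 + Real.log (γ 0 / ν 0) ^ 2) / γ 0 := by
      have : 0 < 1 + Real.log (γ 0 / ν 0) ^ 2 := by positivity
      exact div_pos this (hγ 0)
    exact mul_pos hA (h0.trans_le (hT₀ 0))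
  · intro j s φ hs hφ hodd
    exact hb j (ν j) (hν j) (hνγ j) (A * T₀) (mul_le_mul_of_nonneg_left (hT₀ j) hA.le) s φ hs hφ hodd

end Summit.AnomalousDissipation.AnomalousDissipation.Cruxes.TwohalfdThesis.StrategistCensusS2

end
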